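import Mathlib
import Literature.Probability.PointProcesses.LensConsistentLaw
import Literature.MathematicalPhysics.StatisticalMechanics.LennardJonesClusters
import Summits.AtomisticToContinuum.Crystallization.Theorems.FrustrationRangeCertificatesPatternPricedCertificatesStubLevelLift
import Summits.AtomisticToContinuum.Crystallization.Theorems.FrustrationRangeCertificatesPatternPricedCertificatesStubBoxIntegralShift
import Summits.AtomisticToContinuum.Crystallization.Theorems.FrustrationRangeCertificatesPatternPricedCertificatesStubBoxIntegralFaceCrossing
import Summits.AtomisticToContinuum.Crystallization.Theorems.FrustrationRangeCertificatesPatternPricedCertificatesStubCubeTransport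
import Summits.AtomisticToContinuum.Crystallization.Theorems.FrustrationRangeCertificatesPatternPricedCertificatesStubUnpricedMeanBoundAux
import HarnessLib

/-!
# Crux `PatternPricedCertificates` (stmt-AtomisticToContinuum-12974), line `registered`: stub `stub_unpricedMeanBound`

The unpriced energy bound `⨅_Q e(Q) ≤ ℓ ρ (½ h_ρ)` (`ρ ≥ 1`) for every point-stationary mean family `ℓ` on rooted
`δ`-separated configurations of `ℝ³`, by the SHIFT-AVERAGED CUBE-PARTITION TRANSPORT: for a side `s` the rule
"every point sends `χ(x)/N` to every point `x` of its own cube of `sℤ³ + u`" (`N` = points in that cube,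
`χ = ½h_ρ + (1/24)·#{neighbours within ρ in another cube}`), averaged over the offset `u ∈ [0,s)³`
(`stub_boxIntegral_shift`) and guarded by admissibility, is a bounded transport at range `2s + ρ`; its transport
functional is `(s³)⁻¹∫[cube average of χ − χ(root)]du` (`stub_cubeTransport`), the cube average is `≥ e⋆`
(`unpriced_cubeAverage_ge`, from `stub_clusterEnergyBound`) and `∫χ(root) ≤ s³·½h_ρ(root) + #B_ρ·s²ρ/8`
(`stub_boxIntegral_faceCrossing`); the mass-transport identity then gives `e⋆ − C(δ,ρ)/s ≤ ℓ ρ (½h_ρ)` for all `s`.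
-/

noncomputable section

open scoped BigOperators Classical
open MeasureTheory

namespace Summit.AtomisticToContinuum.Crystallization.Theorems.PatternPricedCertificates

open Literature.Probability.PointProcesses (IsRootedPattern ballPattern lens reroot)
open Literature.MathematicalPhysics.StatisticalMechanics (lennardJones PeriodicConfiguration)

/-- **Stub `stub_unpricedMeanBound` (unpriced energy bound for point-stationary mean families; "no duality
gap at κ = 0").** For every `δ > 0`, every point-stationary mean family on rooted `δ`-separated
configurations of `ℝ³` and every radius `ρ ≥ 1`: `⨅_Q e(Q) ≤ ℓ ρ (½ h_ρ)`. Proof: the shift-averaged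
cube-partition transport (file header). [folklore] -/
theorem stub_unpricedMeanBound :
    ∀ δ : ℝ, 0 < δ → ∀ ℓ : ℝ → (Finset (EuclideanSpace ℝ (Fin 3)) → ℝ) → ℝ,
      (∀ (ρ : ℝ) (f₁ f₂ : Finset (EuclideanSpace ℝ (Fin 3)) → ℝ), ℓ ρ (f₁ + f₂) = ℓ ρ f₁ + ℓ ρ f₂) →
      (∀ (ρ t : ℝ) (f : Finset (EuclideanSpace ℝ (Fin 3)) → ℝ), ℓ ρ (t • f) = t * ℓ ρ f) →
      (∀ (ρ : ℝ) (f : Finset (EuclideanSpace ℝ (Fin 3)) → ℝ), (∀ S : Finset (EuclideanSpace ℝ (Fin 3)), Literature.Probability.PointProcesses.IsRootedPattern δ ρ S → 0 ≤ f S ∧ f S ≤ 1) → 0 ≤ ℓ ρ f) →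
      (∀ ρ : ℝ, ℓ ρ (fun _ => 1) = 1) →
      (∀ ρ ρ' : ℝ, ρ ≤ ρ' → ∀ f : Finset (EuclideanSpace ℝ (Fin 3)) → ℝ, ℓ ρ' (fun S => f (Literature.Probability.PointProcesses.ballPattern ρ S)) = ℓ ρ f) →
      (∀ r ρ : ℝ, 0 ≤ r → ∀ g : EuclideanSpace ℝ (Fin 3) → Finset (EuclideanSpace ℝ (Fin 3)) → Finset (EuclideanSpace ℝ (Fin 3)) → ℝ, (∃ M : ℝ, ∀ v p q, |g v p q| ≤ M) →
        ℓ ρ (fun S => ∑ v ∈ Literature.Probability.PointProcesses.lens r ρ S, (g v (Literature.Probability.PointProcesses.ballPattern r S) (Literature.Probability.PointProcesses.ballPattern r (Literature.Probability.PointProcesses.reroot S v)) - g (-v) (Literature.Probability.PointProcesses.ballPattern r (Literature.Probability.PointProcesses.reroot S v)) (Literature.Probability.PointProcesses.ballPattern r S))) = 0) →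
      ∀ ρ : ℝ, 1 ≤ ρ → (⨅ Q : Literature.MathematicalPhysics.StatisticalMechanics.PeriodicConfiguration 3, Q.energyPerParticle Literature.MathematicalPhysics.StatisticalMechanics.lennardJones) ≤
        ℓ ρ (fun S => (∑ v ∈ S, Literature.MathematicalPhysics.StatisticalMechanics.lennardJones ‖v‖) / 2) := by
  intro δ hδ ℓ hadd hsmul hpos hone hproj hmtp ρ hρ1
  set estar : ℝ := ⨅ Q : PeriodicConfiguration 3, Q.energyPerParticle lennardJones with hestar
  set φ : Finset (EuclideanSpace ℝ (Fin 3)) → ℝ := fun S => (∑ v ∈ S, lennardJones ‖v‖) / 2 with hφ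
  obtain ⟨MV, hMV⟩ := levelLift_abs_sum_le hδ ρ
  have hMV0 : 0 ≤ MV := (abs_nonneg _).trans (hMV ∅ (Literature.Probability.PointProcesses.isRootedPattern_empty δ ρ))
  set Cρ : ℝ := (2 * max ρ 0 / δ + 1) ^ 3 with hCρ
  have hCρ0 : 0 ≤ Cρ := by positivity
  have hcardρ : ∀ S : Finset (EuclideanSpace ℝ (Fin 3)), IsRootedPattern δ ρ S → (S.card : ℝ) ≤ Cρ := fun S hS => meanDuality_card_le hδ hS
  have hρ0 : 0 < ρ := by linarith
  set K : ℝ := Cρ * ρ / 8 with hK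
  have hK0 : 0 ≤ K := by positivity
  -- it suffices to prove `e⋆ − K/s ≤ ℓ ρ φ` for every `s ≥ 1`
  suffices hmain : ∀ s : ℝ, 1 ≤ s → estar - K / s ≤ ℓ ρ φ by
    refine le_of_forall_pos_lt_add fun ε hε => ?_
    have h := hmain (K / ε + 1) (by linarith [div_nonneg hK0 hε.le])
    have hKs : K / (K / ε + 1) < ε := by
      rw [div_lt_iff₀ (by positivity)]
      have : ε * (K / ε + 1) = K + ε := by field_simp
      linarith
    linarith
  intro s hs1
  obtain ⟨hs, hs0⟩ : 0 < s ∧ s ≠ 0 := ⟨by linarith, by positivity⟩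
  set r : ℝ := 2 * s + ρ with hr
  set L : ℝ := r + 2 * s with hL
  have hr2 : 2 * s ≤ r := by linarith
  have hρr : ρ ≤ r := by linarith
  obtain ⟨hrL, hr0, hρL⟩ : r + 2 * s ≤ L ∧ 0 ≤ r ∧ ρ ≤ L := ⟨le_rfl, by linarith, by linarith⟩
  obtain ⟨hvol, hface⟩ := stub_boxIntegral_faceCrossing s hs
  set box : Set (Fin 3 → ℝ) := Set.pi Set.univ (fun _ : Fin 3 => Set.Ico (0 : ℝ) s) with hbox
  have hboxmeas : MeasurableSet box := MeasurableSet.univ_pi fun _ => measurableSet_Ico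
  have hvol_lt : volume box < ⊤ := by rw [hvol]; exact ENNReal.ofReal_lt_top
  have hvol_real : volume.real box = s ^ 3 := by
    rw [measureReal_def, hvol, ENNReal.toReal_ofReal (by positivity)]
  -- the site functional `χ = ½h_ρ + (1/24)·#(cross-cube neighbours within ρ)` and the transport integrand `G`
  obtain ⟨χ, hχ⟩ : ∃ χ : Finset (EuclideanSpace ℝ (Fin 3)) → (Fin 3 → ℝ) → ℝ, ∀ q u', χ q u' =
      (∑ z ∈ ballPattern ρ q, lennardJones ‖z‖) / 2 +
        (1 / 24) * (((ballPattern ρ q).filter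
          (fun z => ¬ ∀ i : Fin 3, ⌊(z i - u' i) / s⌋ = ⌊(0 - u' i) / s⌋)).card : ℝ) :=
    ⟨fun q u' => (∑ z ∈ ballPattern ρ q, lennardJones ‖z‖) / 2 +
        (1 / 24) * (((ballPattern ρ q).filter
          (fun z => ¬ ∀ i : Fin 3, ⌊(z i - u' i) / s⌋ = ⌊(0 - u' i) / s⌋)).card : ℝ), fun _ _ => rfl⟩
  obtain ⟨G, hG⟩ : ∃ G : (EuclideanSpace ℝ (Fin 3)) → Finset (EuclideanSpace ℝ (Fin 3)) → Finset (EuclideanSpace ℝ (Fin 3)) → (Fin 3 → ℝ) → ℝ, ∀ v p q u, G v p q u =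
      if (∀ i : Fin 3, ⌊(v i - u i) / s⌋ = ⌊(0 - u i) / s⌋) then
        χ q (fun i => u i - v i) /
          (((insert (0 : (EuclideanSpace ℝ (Fin 3))) p).filter
            (fun w => ∀ i : Fin 3, ⌊(w i - u i) / s⌋ = ⌊(0 - u i) / s⌋)).card : ℝ)
      else 0 :=
    ⟨fun v p q u => if (∀ i : Fin 3, ⌊(v i - u i) / s⌋ = ⌊(0 - u i) / s⌋) then
        χ q (fun i => u i - v i) /
          (((insert (0 : (EuclideanSpace ℝ (Fin 3))) p).filter
            (fun w => ∀ i : Fin 3, ⌊(w i - u i) / s⌋ = ⌊(0 - u i) / s⌋)).card : ℝ)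
      else 0, fun _ _ _ _ => rfl⟩
  -- the transport rule: the box average of `G`, guarded by admissibility of both patterns
  obtain ⟨g, hg⟩ : ∃ g : (EuclideanSpace ℝ (Fin 3)) → Finset (EuclideanSpace ℝ (Fin 3)) → Finset (EuclideanSpace ℝ (Fin 3)) → ℝ, ∀ v p q, g v p q =
      if IsRootedPattern δ r p ∧ IsRootedPattern δ r q then (s ^ 3)⁻¹ * ∫ u in box, G v p q u else 0 :=
    ⟨fun v p q => if IsRootedPattern δ r p ∧ IsRootedPattern δ r q then
      (s ^ 3)⁻¹ * ∫ u in box, G v p q u else 0, fun _ _ _ => rfl⟩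
  set Mχ : ℝ := MV / 2 + Cρ / 24 with hMχ
  have hMχ0 : 0 ≤ Mχ := by positivity
  have hχbd : ∀ q : Finset (EuclideanSpace ℝ (Fin 3)), IsRootedPattern δ r q → ∀ u' : Fin 3 → ℝ, |χ q u'| ≤ Mχ := by
    intro q hq u'
    have hqρ : IsRootedPattern δ ρ (ballPattern ρ q) := levelLift_isRootedPattern_ballPattern ρ hq
    have h1 := hMV _ hqρ
    have h2 : (((ballPattern ρ q).filter
        (fun z => ¬ ∀ i : Fin 3, ⌊(z i - u' i) / s⌋ = ⌊(0 - u' i) / s⌋)).card : ℝ) ≤ Cρ :=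
      le_trans (by exact_mod_cast Finset.card_filter_le _ _) (hcardρ _ hqρ)
    have h3 : (0 : ℝ) ≤ (((ballPattern ρ q).filter
        (fun z => ¬ ∀ i : Fin 3, ⌊(z i - u' i) / s⌋ = ⌊(0 - u' i) / s⌋)).card : ℝ) := by positivity
    rw [hχ, abs_le]
    rw [abs_le] at h1
    constructor <;> linarith
  have hcount_pos : ∀ (p : Finset (EuclideanSpace ℝ (Fin 3))) (u : Fin 3 → ℝ), (1 : ℝ) ≤ (((insert (0 : (EuclideanSpace ℝ (Fin 3))) p).filter
      (fun w => ∀ i : Fin 3, ⌊(w i - u i) / s⌋ = ⌊(0 - u i) / s⌋)).card : ℝ) := by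
    intro p u
    have hmem : (0 : (EuclideanSpace ℝ (Fin 3))) ∈ (insert (0 : (EuclideanSpace ℝ (Fin 3))) p).filter
        (fun w => ∀ i : Fin 3, ⌊(w i - u i) / s⌋ = ⌊(0 - u i) / s⌋) := by
      simp only [Finset.mem_filter, Finset.mem_insert, true_or, true_and]
      intro i; simp
    exact_mod_cast Finset.card_pos.2 ⟨0, hmem⟩
  have hGbd : ∀ (v : (EuclideanSpace ℝ (Fin 3))) (p q : Finset (EuclideanSpace ℝ (Fin 3))), IsRootedPattern δ r q → ∀ u, |G v p q u| ≤ Mχ := by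
    intro v p q hq u
    rw [hG]
    split_ifs with hc
    · have hN1 := hcount_pos p u
      rw [abs_div, Nat.abs_cast]
      calc |χ q (fun i => u i - v i)| / (((insert (0 : (EuclideanSpace ℝ (Fin 3))) p).filter
              (fun w => ∀ i : Fin 3, ⌊(w i - u i) / s⌋ = ⌊(0 - u i) / s⌋)).card : ℝ)
          ≤ |χ q (fun i => u i - v i)| / 1 :=
            div_le_div_of_nonneg_left (abs_nonneg _) one_pos hN1
        _ ≤ Mχ := by rw [div_one]; exact hχbd q hq _
    · simpa using hMχ0
  have hgbd : ∀ v p q, |g v p q| ≤ Mχ := by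
    intro v p q
    rw [hg]
    split_ifs with hpq
    · have hint : ‖∫ u in box, G v p q u‖ ≤ Mχ * volume.real box :=
        norm_setIntegral_le_of_norm_le_const hvol_lt fun u _ => by
          rw [Real.norm_eq_abs]; exact hGbd v p q hpq.2 u
      rw [hvol_real, Real.norm_eq_abs] at hint
      rw [abs_mul, abs_inv, abs_of_pos (by positivity : (0 : ℝ) < s ^ 3)]
      calc (s ^ 3)⁻¹ * |∫ u in box, G v p q u| ≤ (s ^ 3)⁻¹ * (Mχ * s ^ 3) := by gcongr
        _ = Mχ := by field_simp
    · simpa using hMχ0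
  -- measurability and periodicity of the integrands
  have hχmeas : ∀ (q : Finset (EuclideanSpace ℝ (Fin 3))) (d : Fin 3 → ℝ), Measurable (fun u : Fin 3 → ℝ => χ q (fun i => u i - d i)) := by
    intro q d
    have h2 : (fun u : Fin 3 → ℝ => χ q (fun i => u i - d i)) = fun u =>
        (∑ z ∈ ballPattern ρ q, lennardJones ‖z‖) / 2 + (1 / 24) * ∑ z ∈ ballPattern ρ q,
          (if (∀ i : Fin 3, ⌊(z i - (u i - d i)) / s⌋ = ⌊(0 - (u i - d i)) / s⌋) then (0 : ℝ) else 1) := by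
      funext u
      rw [hχ, Finset.natCast_card_filter]
      congr 2
      exact Finset.sum_congr rfl fun z _ => ite_not _ _ _
    rw [h2]
    refine Measurable.const_add (Measurable.const_mul (Finset.measurable_sum _ fun z _ => ?_) _) _
    refine Measurable.ite ?_ measurable_const measurable_const
    exact unpriced_measurableSet_floor (f := fun i u => (z i - (u i - d i)) / s)
      (g := fun i u => (0 - (u i - d i)) / s) (fun i => by fun_prop) (fun i => by fun_prop)
  have hNmeas : ∀ p : Finset (EuclideanSpace ℝ (Fin 3)), Measurable (fun u : Fin 3 → ℝ => ((((insert (0 : (EuclideanSpace ℝ (Fin 3))) p).filter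
      (fun w => ∀ i : Fin 3, ⌊(w i - u i) / s⌋ = ⌊(0 - u i) / s⌋)).card : ℝ))) := by
    intro p
    have h2 : (fun u : Fin 3 → ℝ => ((((insert (0 : (EuclideanSpace ℝ (Fin 3))) p).filter
        (fun w => ∀ i : Fin 3, ⌊(w i - u i) / s⌋ = ⌊(0 - u i) / s⌋)).card : ℝ))) = fun u =>
        ∑ w ∈ insert (0 : (EuclideanSpace ℝ (Fin 3))) p, (if (∀ i : Fin 3, ⌊(w i - u i) / s⌋ = ⌊(0 - u i) / s⌋) then (1 : ℝ) else 0) := by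
      funext u
      rw [Finset.natCast_card_filter]
    rw [h2]
    refine Finset.measurable_sum _ fun w _ => ?_
    refine Measurable.ite ?_ measurable_const measurable_const
    exact unpriced_measurableSet_floor (f := fun i u => (w i - u i) / s)
      (g := fun i u => (0 - u i) / s) (fun i => by fun_prop) (fun i => by fun_prop)
  have hGmeas : ∀ (v : (EuclideanSpace ℝ (Fin 3))) (p q : Finset (EuclideanSpace ℝ (Fin 3))), Measurable (fun u => G v p q u) := by
    intro v p q
    have h1 : (fun u => G v p q u) = fun u => if (∀ i : Fin 3, ⌊(v i - u i) / s⌋ = ⌊(0 - u i) / s⌋) then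
        χ q (fun i => u i - v i) /
          (((insert (0 : (EuclideanSpace ℝ (Fin 3))) p).filter
            (fun w => ∀ i : Fin 3, ⌊(w i - u i) / s⌋ = ⌊(0 - u i) / s⌋)).card : ℝ)
        else 0 := funext fun u => hG v p q u
    rw [h1]
    refine Measurable.ite ?_ ((hχmeas q (fun i => v i)).div (hNmeas p)) measurable_const
    exact unpriced_measurableSet_floor (f := fun i u => (v i - u i) / s)
      (g := fun i u => (0 - u i) / s) (fun i => by fun_prop) (fun i => by fun_prop)
  have hGmeas' : ∀ (w v : (EuclideanSpace ℝ (Fin 3))) (p q : Finset (EuclideanSpace ℝ (Fin 3))),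
      Measurable (fun u : Fin 3 → ℝ => G w p q (fun i => u i - v i)) := by
    intro w v p q
    exact (hGmeas w p q).comp (by fun_prop)
  have hGper : ∀ (v : (EuclideanSpace ℝ (Fin 3))) (p q : Finset (EuclideanSpace ℝ (Fin 3))) (u : Fin 3 → ℝ) (i : Fin 3),
      G v p q (u + Pi.single i s) = G v p q u := by
    intro v p q u i
    rw [hG, hG]
    have hc : (∀ j : Fin 3, ⌊(v j - ((u + Pi.single i s : Fin 3 → ℝ) j)) / s⌋ =
          ⌊(0 - ((u + Pi.single i s : Fin 3 → ℝ) j)) / s⌋) ↔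
        (∀ j : Fin 3, ⌊(v j - u j) / s⌋ = ⌊(0 - u j) / s⌋) :=
      unpriced_sc_add_single hs0 u i (fun j => v j) (fun _ => 0)
    have hN : ((insert (0 : (EuclideanSpace ℝ (Fin 3))) p).filter
        (fun w => ∀ j : Fin 3, ⌊(w j - ((u + Pi.single i s : Fin 3 → ℝ) j)) / s⌋ =
          ⌊(0 - ((u + Pi.single i s : Fin 3 → ℝ) j)) / s⌋)) =
        ((insert (0 : (EuclideanSpace ℝ (Fin 3))) p).filter (fun w => ∀ j : Fin 3, ⌊(w j - u j) / s⌋ = ⌊(0 - u j) / s⌋)) :=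
      Finset.filter_congr fun w _ => unpriced_sc_add_single hs0 u i (fun j => w j) (fun _ => 0)
    have hF : ∀ z : (EuclideanSpace ℝ (Fin 3)), ((ballPattern ρ q).filter
        (fun z => ¬ ∀ j : Fin 3, ⌊(z j - (((u + Pi.single i s : Fin 3 → ℝ) j) - v j)) / s⌋ =
          ⌊(0 - (((u + Pi.single i s : Fin 3 → ℝ) j) - v j)) / s⌋)) =
        ((ballPattern ρ q).filter
          (fun z => ¬ ∀ j : Fin 3, ⌊(z j - (u j - v j)) / s⌋ = ⌊(0 - (u j - v j)) / s⌋)) := fun _ =>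
      Finset.filter_congr fun z _ =>
        not_congr (unpriced_sc_add_single' hs0 u (fun j => v j) i (fun j => z j) (fun _ => 0))
    have hχ' : χ q (fun j => (u + Pi.single i s : Fin 3 → ℝ) j - v j) = χ q (fun j => u j - v j) := by
      rw [hχ, hχ, hF 0]
    rw [hN, hχ']
    exact if_congr hc rfl rfl
  have hint : ∀ (v : (EuclideanSpace ℝ (Fin 3))) (p q : Finset (EuclideanSpace ℝ (Fin 3))), IsRootedPattern δ r q →
      IntegrableOn (fun u => G v p q u) box volume := fun v p q hq =>
    unpriced_integrableOn_box hvol (hGmeas v p q) (hGbd v p q hq)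
  have hint' : ∀ (w v : (EuclideanSpace ℝ (Fin 3))) (p q : Finset (EuclideanSpace ℝ (Fin 3))), IsRootedPattern δ r q →
      IntegrableOn (fun u : Fin 3 → ℝ => G w p q (fun i => u i - v i)) box volume := fun w v p q hq =>
    unpriced_integrableOn_box hvol (hGmeas' w v p q) (fun u => hGbd w p q hq _)
  have hT0 := hmtp r L hr0 g ⟨Mχ, hgbd⟩
  set T : Finset (EuclideanSpace ℝ (Fin 3)) → ℝ := fun S => ∑ v ∈ lens r L S,
      (g v (ballPattern r S) (ballPattern r (reroot S v)) -
        g (-v) (ballPattern r (reroot S v)) (ballPattern r S)) with hTdef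
  -- the key pointwise inequality on admissible patterns
  have hkey : ∀ S : Finset (EuclideanSpace ℝ (Fin 3)), IsRootedPattern δ L S → estar - K / s - T S ≤ φ (ballPattern ρ S) := by
    intro S hS
    set p : Finset (EuclideanSpace ℝ (Fin 3)) := ballPattern r S with hp
    have hpadm : IsRootedPattern δ r p := levelLift_isRootedPattern_ballPattern r hS
    have hqadm : ∀ v ∈ S, IsRootedPattern δ r (ballPattern r (reroot S v)) :=
      fun v hv => unpriced_isRootedPattern_reroot hδ hS hv
    have hlensS : ∀ v ∈ lens r L S, v ∈ S := fun v hv => (Finset.mem_filter.1 hv).1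
    -- (a) the transport functional as ONE box integral
    have hTS : T S = (s ^ 3)⁻¹ * ∫ u in box, ∑ v ∈ lens r L S,
        (G v p (ballPattern r (reroot S v)) u -
          G (-v) (ballPattern r (reroot S v)) p (fun i => u i - v i)) := by
      show (∑ v ∈ lens r L S, (g v p (ballPattern r (reroot S v)) -
          g (-v) (ballPattern r (reroot S v)) p)) = _
      rw [integral_finsetSum _ (fun v hv => (hint v p _ (hqadm v (hlensS v hv))).sub'
        (hint' (-v) v _ p hpadm)), Finset.mul_sum]
      refine Finset.sum_congr rfl fun v hv => ?_
      have hvS := hlensS v hv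
      rw [hg, if_pos ⟨hpadm, hqadm v hvS⟩, hg, if_pos ⟨hqadm v hvS, hpadm⟩,
        integral_sub (hint v p _ (hqadm v hvS)) (hint' (-v) v _ p hpadm), mul_sub]
      congr 2
      have hshift := stub_boxIntegral_shift s hs (fun u => G (-v) (ballPattern r (reroot S v)) p u) (hGmeas _ _ _)
        ⟨Mχ, hGbd _ _ _ hpadm⟩ (fun u i => hGper _ _ _ u i) (fun i => -v i)
      rw [← hshift]
      congr 1
    -- (b) the integrand is the cube average of χ minus χ at the root (stub D)
    have hDS : ∀ u : Fin 3 → ℝ, ∑ v ∈ lens r L S,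
        (G v p (ballPattern r (reroot S v)) u -
          G (-v) (ballPattern r (reroot S v)) p (fun i => u i - v i)) =
        ((((insert (0 : (EuclideanSpace ℝ (Fin 3))) p).filter
            (fun w => ∀ i : Fin 3, ⌊(w i - u i) / s⌋ = ⌊(0 - u i) / s⌋)).card : ℝ))⁻¹ *
          ∑ w ∈ (insert (0 : (EuclideanSpace ℝ (Fin 3))) p).filter
              (fun w => ∀ i : Fin 3, ⌊(w i - u i) / s⌋ = ⌊(0 - u i) / s⌋),
            χ (ballPattern r (reroot S w)) (fun i => u i - w i) - χ p u :=
      fun u => stub_cubeTransport s r L δ hs hr2 hrL hδ χ G hG u S hS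
    -- (c) the cube average is ≥ e⋆ pointwise
    have hcube : ∀ u : Fin 3 → ℝ, estar ≤ ((((insert (0 : (EuclideanSpace ℝ (Fin 3))) p).filter
            (fun w => ∀ i : Fin 3, ⌊(w i - u i) / s⌋ = ⌊(0 - u i) / s⌋)).card : ℝ))⁻¹ *
          ∑ w ∈ (insert (0 : (EuclideanSpace ℝ (Fin 3))) p).filter
              (fun w => ∀ i : Fin 3, ⌊(w i - u i) / s⌋ = ⌊(0 - u i) / s⌋),
            χ (ballPattern r (reroot S w)) (fun i => u i - w i) :=
      fun u => unpriced_cubeAverage_ge s ρ r hs hρ1 hρr hr2 S χ hχ u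
    -- (d) χ at the root: ½h_ρ plus the cross-cube count, whose box integral is small (stub A2)
    have hχroot : ∀ u : Fin 3 → ℝ, χ p u = φ (ballPattern ρ S) + (1 / 24) * ∑ z ∈ ballPattern ρ S,
        (if (∀ i : Fin 3, ⌊(z i - u i) / s⌋ = ⌊(0 - u i) / s⌋) then (0 : ℝ) else 1) := by
      intro u
      rw [hχ, hp, levelRestrict_ballPattern_ballPattern hρr, Finset.natCast_card_filter]
      congr 2
      exact Finset.sum_congr rfl fun z _ => ite_not _ _ _
    have hind_meas : ∀ z : (EuclideanSpace ℝ (Fin 3)), Measurable (fun u : Fin 3 → ℝ =>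
        (if (∀ i : Fin 3, ⌊(z i - u i) / s⌋ = ⌊(0 - u i) / s⌋) then (0 : ℝ) else 1)) := by
      intro z
      refine Measurable.ite ?_ measurable_const measurable_const
      exact unpriced_measurableSet_floor (f := fun i u => (z i - u i) / s)
        (g := fun i u => (0 - u i) / s) (fun i => by fun_prop) (fun i => by fun_prop)
    have hind_int : ∀ z : (EuclideanSpace ℝ (Fin 3)), IntegrableOn (fun u : Fin 3 → ℝ =>
        (if (∀ i : Fin 3, ⌊(z i - u i) / s⌋ = ⌊(0 - u i) / s⌋) then (0 : ℝ) else 1)) box volume := by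
      intro z
      refine unpriced_integrableOn_box hvol (hind_meas z) (M := 1) fun u => ?_
      split_ifs <;> simp
    have hSρ : IsRootedPattern δ ρ (ballPattern ρ S) := levelLift_isRootedPattern_ballPattern ρ hS
    have hcross : ∫ u in box, (∑ z ∈ ballPattern ρ S,
        (if (∀ i : Fin 3, ⌊(z i - u i) / s⌋ = ⌊(0 - u i) / s⌋) then (0 : ℝ) else 1)) ≤
        Cρ * (s ^ 2 * (3 * ρ)) := by
      rw [integral_finsetSum _ (fun z _ => hind_int z)]
      calc ∑ z ∈ ballPattern ρ S, ∫ u in box,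
              (if (∀ i : Fin 3, ⌊(z i - u i) / s⌋ = ⌊(0 - u i) / s⌋) then (0 : ℝ) else 1)
          ≤ ∑ z ∈ ballPattern ρ S, s ^ 2 * (3 * ρ) := by
            refine Finset.sum_le_sum fun z hz => (hface z).trans ?_
            have hzρ : ‖z‖ ≤ ρ := (hSρ.1 z hz).2
            have hzi : ∀ i : Fin 3, |z i| ≤ ρ := fun i => by
              have := PiLp.norm_apply_le z i
              rw [Real.norm_eq_abs] at this
              exact this.trans hzρ
            have h0 := hzi 0
            have h1 := hzi 1
            have h2 := hzi 2
            have : |z 0| + |z 1| + |z 2| ≤ 3 * ρ := by linarith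
            gcongr
        _ = (ballPattern ρ S).card * (s ^ 2 * (3 * ρ)) := by rw [Finset.sum_const, nsmul_eq_mul]
        _ ≤ Cρ * (s ^ 2 * (3 * ρ)) := by gcongr; exact hcardρ _ hSρ
    have hint_sum : IntegrableOn (fun u => ∑ v ∈ lens r L S,
        (G v p (ballPattern r (reroot S v)) u -
          G (-v) (ballPattern r (reroot S v)) p (fun i => u i - v i))) box volume :=
      integrable_finsetSum _ fun v hv =>
        (hint v p _ (hqadm v (hlensS v hv))).sub' (hint' (-v) v _ p hpadm)
    have hIc : ∀ c : ℝ, Integrable (fun _ : Fin 3 → ℝ => c) (volume.restrict box) := fun c =>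
      integrableOn_const (hs := hvol_lt.ne)
    have hIsum : Integrable (fun u : Fin 3 → ℝ => (1 / 24 : ℝ) * ∑ z ∈ ballPattern ρ S,
        (if (∀ i : Fin 3, ⌊(z i - u i) / s⌋ = ⌊(0 - u i) / s⌋) then (0 : ℝ) else 1))
        (volume.restrict box) :=
      Integrable.const_mul (integrable_finsetSum _ fun z _ => hind_int z) _
    have hint_rhs : IntegrableOn (fun u => estar - (φ (ballPattern ρ S) + (1 / 24) *
        ∑ z ∈ ballPattern ρ S,
          (if (∀ i : Fin 3, ⌊(z i - u i) / s⌋ = ⌊(0 - u i) / s⌋) then (0 : ℝ) else 1))) box volume :=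
      (hIc estar).sub' ((hIc _).fun_add hIsum)
    have hlow : ∫ u in box, (estar - (φ (ballPattern ρ S) + (1 / 24) *
        ∑ z ∈ ballPattern ρ S,
          (if (∀ i : Fin 3, ⌊(z i - u i) / s⌋ = ⌊(0 - u i) / s⌋) then (0 : ℝ) else 1))) ≤
        ∫ u in box, ∑ v ∈ lens r L S,
          (G v p (ballPattern r (reroot S v)) u -
            G (-v) (ballPattern r (reroot S v)) p (fun i => u i - v i)) := by
      refine setIntegral_mono_on hint_rhs hint_sum hboxmeas fun u _ => ?_
      rw [hDS u, ← hχroot u]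
      linarith [hcube u]
    have hlow_val : ∫ u in box, (estar - (φ (ballPattern ρ S) + (1 / 24) *
        ∑ z ∈ ballPattern ρ S,
          (if (∀ i : Fin 3, ⌊(z i - u i) / s⌋ = ⌊(0 - u i) / s⌋) then (0 : ℝ) else 1))) =
        s ^ 3 * estar - (s ^ 3 * φ (ballPattern ρ S) + (1 / 24) * ∫ u in box,
          ∑ z ∈ ballPattern ρ S,
            (if (∀ i : Fin 3, ⌊(z i - u i) / s⌋ = ⌊(0 - u i) / s⌋) then (0 : ℝ) else 1)) := by
      rw [integral_sub (hIc estar) ((hIc _).fun_add hIsum), integral_add (hIc _) hIsum,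
        integral_const_mul, setIntegral_const, setIntegral_const, hvol_real, smul_eq_mul, smul_eq_mul]
    have hs3 : (0 : ℝ) < s ^ 3 := by positivity
    have hTS' : s ^ 3 * T S = ∫ u in box, ∑ v ∈ lens r L S,
        (G v p (ballPattern r (reroot S v)) u -
          G (-v) (ballPattern r (reroot S v)) p (fun i => u i - v i)) := by
      rw [hTS]; field_simp
    have hKs : K / s * s ^ 3 = (1 / 24) * (Cρ * (s ^ 2 * (3 * ρ))) := by
      rw [hK]; field_simp; ring
    have hfinal : s ^ 3 * (estar - K / s - T S) ≤ s ^ 3 * φ (ballPattern ρ S) := by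
      nlinarith [hlow, hlow_val, hTS', hKs, hcross]
    exact le_of_mul_le_mul_left hfinal hs3
  obtain ⟨CL, hCL⟩ : ∃ CL : ℝ, ∀ S : Finset (EuclideanSpace ℝ (Fin 3)), IsRootedPattern δ L S → ((lens r L S).card : ℝ) ≤ CL :=
    ⟨(2 * max L 0 / δ + 1) ^ 3, fun S hS =>
      le_trans (by exact_mod_cast Finset.card_filter_le _ _) (meanDuality_card_le hδ hS)⟩
  have hCL0 : 0 ≤ CL := le_trans (by positivity) (hCL ∅ (Literature.Probability.PointProcesses.isRootedPattern_empty δ L))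
  have hTbd : ∀ S : Finset (EuclideanSpace ℝ (Fin 3)), IsRootedPattern δ L S → |T S| ≤ CL * (2 * Mχ) := by
    intro S hS
    calc |T S| ≤ ∑ v ∈ lens r L S, |g v (ballPattern r S) (ballPattern r (reroot S v)) -
          g (-v) (ballPattern r (reroot S v)) (ballPattern r S)| := Finset.abs_sum_le_sum_abs _ _
      _ ≤ ∑ _v ∈ lens r L S, 2 * Mχ := Finset.sum_le_sum fun v _ => by
          have h1 := hgbd v (ballPattern r S) (ballPattern r (reroot S v))
          have h2 := hgbd (-v) (ballPattern r (reroot S v)) (ballPattern r S)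
          rw [abs_le] at h1 h2 ⊢
          constructor <;> linarith [h1.1, h1.2, h2.1, h2.2]
      _ = (lens r L S).card * (2 * Mχ) := by rw [Finset.sum_const, nsmul_eq_mul]
      _ ≤ CL * (2 * Mχ) := by gcongr; exact hCL S hS
  have hφbd : ∀ S : Finset (EuclideanSpace ℝ (Fin 3)), IsRootedPattern δ L S → |φ (ballPattern ρ S)| ≤ MV / 2 := by
    intro S hS
    have h := hMV _ (levelLift_isRootedPattern_ballPattern ρ hS)
    simp only [hφ]
    rw [abs_div, abs_two]
    linarith
  have hMpos : 0 < MV / 2 + |estar| + K / s + CL * (2 * Mχ) + 1 := by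
    have h1 : 0 ≤ K / s := div_nonneg hK0 hs.le
    have h2 : 0 ≤ CL * (2 * Mχ) := mul_nonneg hCL0 (by linarith)
    linarith [abs_nonneg estar]
  have hbd2 : ∀ S : Finset (EuclideanSpace ℝ (Fin 3)), IsRootedPattern δ L S →
      φ (ballPattern ρ S) - (estar - K / s - T S) ≤ MV / 2 + |estar| + K / s + CL * (2 * Mχ) + 1 := by
    intro S hS
    have h1 := hTbd S hS
    have h2 := hφbd S hS
    rw [abs_le] at h1 h2
    linarith [h1.1, h1.2, h2.1, h2.2, le_abs_self estar, neg_abs_le estar]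
  have hmono : ℓ L (fun S => estar - K / s - T S) ≤ ℓ L (fun S => φ (ballPattern ρ S)) :=
    levelLift_mean_mono (Ω := fun S => IsRootedPattern δ L S) (m := ℓ L) (hadd L) (hsmul L) (hpos L)
      (f := fun S => estar - K / s - T S) (g := fun S => φ (ballPattern ρ S)) hMpos hkey hbd2
  have hTℓ : ℓ L T = 0 := hT0
  have hleft : ℓ L (fun S => estar - K / s - T S) = estar - K / s := by
    have : (fun S => estar - K / s - T S) = (fun _ => estar - K / s) + (-1 : ℝ) • T := by
      funext S; simp only [Pi.add_apply, Pi.smul_apply, smul_eq_mul]; ring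
    rw [this, hadd, hsmul, levelLift_mean_const (hsmul L) (hone L), hTℓ]
    ring
  have hright : ℓ L (fun S => φ (ballPattern ρ S)) = ℓ ρ φ := hproj ρ L hρL φ
  linarith [hmono]

end Summit.AtomisticToContinuum.Crystallization.Theorems.PatternPricedCertificates

end
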